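import Mathlib
import Summits.Ventures.PercRepro2.Defs
import Summits.Ventures.PercRepro2.Independence
import Summits.Ventures.PercRepro2.Harris
import Summits.Ventures.PercRepro2.Graph
import Summits.Ventures.PercRepro2.Events
import Summits.Ventures.PercRepro2.ZCForest
import Summits.Ventures.PercRepro2.ZCMixedChain

/-!
# (ZC) on every graph that strips to a forest through the four degree-two insertions
(blind cell PercRepro2, mine-a g24; MINE-A.md §72.9)

`zc_of_mixed_chain` with the base supplied by the forest theorem `zc_of_forest_support`: if the
positive-weight edges outside a mixed chain of insertions form a simple forest, (ZC) holds for every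
cluster up-set.  The support of `L.foldl (fun q r => q[r.f₁, r.f₂ ↦ 0]) p` is the set of
positive-weight edges that are no record edge (`foldl_update_two_zero_ne_zero_iff`).  One seat.
-/

namespace Summit.Ventures.PercRepro2

section MixedChainForest

variable {V : Type*} [Fintype V] [DecidableEq V] {E : Type*} [Fintype E] [DecidableEq E]
  {R : Type*} [CommRing R] [LinearOrder R] [IsStrictOrderedRing R]

omit [Fintype V] [DecidableEq V] [Fintype E] [LinearOrder R] [IsStrictOrderedRing R] in
/-- The support of the weights with all record edges removed. -/
lemma foldl_update_two_zero_ne_zero_iff (L : List (Fin 4 × E × E × V × V × V × V × V)) :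
    ∀ (p : E → R) (e : E),
      L.foldl (fun q r => Function.update (Function.update q r.2.1 0) r.2.2.1 0) p e ≠ 0 ↔
        (∀ r ∈ L, e ≠ r.2.1 ∧ e ≠ r.2.2.1) ∧ p e ≠ 0 := by
  induction L with
  | nil => intro p e; simp
  | cons r L ih =>
    intro p e
    rw [List.foldl_cons, ih]
    simp only [List.mem_cons, forall_eq_or_imp]
    constructor
    · intro h
      obtain ⟨hL, hne⟩ := h
      by_cases h2 : e = r.2.2.1
      · subst h2; simp at hne
      · by_cases h1 : e = r.2.1
        · subst h1; simp [Function.update_of_ne h2] at hne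
        · rw [Function.update_of_ne h2, Function.update_of_ne h1] at hne
          exact ⟨⟨⟨h1, h2⟩, hL⟩, hne⟩
    · intro h
      obtain ⟨⟨⟨h1, h2⟩, hL⟩, hne⟩ := h
      refine ⟨hL, ?_⟩
      rw [Function.update_of_ne h2, Function.update_of_ne h1]
      exact hne

/-- **(ZC) on a forest plus a mixed chain of degree-two insertions**: under the chain hypotheses of
`zc_of_mixed_chain`, if the positive-weight edges that are no record edge carry no loop and no
parallel pair and form an acyclic graph, then (ZC) holds for the first record's marks (`m`) and every
up-set. -/
theorem zc_of_mixed_chain_forest {ends : E → Sym2 V} (L : List (Fin 4 × E × E × V × V × V × V × V))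
    (hrec : ∀ r ∈ L, r.2.1 ≠ r.2.2.1 ∧ ends r.2.2.1 = s(r.2.2.2.1, r.2.2.2.2.1) ∧
      ((r.1 = 0 ∧ r.2.2.2.1 = r.2.2.2.2.2.2.1 ∧ ends r.2.1 = s(r.2.2.2.1, r.2.2.2.2.2.1)
          ∧ r.2.2.2.1 ≠ r.2.2.2.2.2.1 ∧ r.2.2.2.1 ≠ r.2.2.2.2.2.2.2) ∨
       (r.1 = 1 ∧ r.2.2.2.1 = r.2.2.2.2.2.1 ∧ ends r.2.1 = s(r.2.2.2.1, r.2.2.2.2.2.2.1)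
          ∧ r.2.2.2.1 ≠ r.2.2.2.2.2.2.1 ∧ r.2.2.2.1 ≠ r.2.2.2.2.2.2.2) ∨
       (r.1 = 2 ∧ r.2.2.2.1 = r.2.2.2.2.2.2.2 ∧ ends r.2.1 = s(r.2.2.2.1, r.2.2.2.2.2.1)
          ∧ r.2.2.2.1 ≠ r.2.2.2.2.2.1 ∧ r.2.2.2.1 ≠ r.2.2.2.2.2.2.1) ∨
       (r.1 = 3 ∧ r.2.2.2.1 = r.2.2.2.2.2.1 ∧ ends r.2.1 = s(r.2.2.2.1, r.2.2.2.2.2.2.2)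
          ∧ r.2.2.2.1 ≠ r.2.2.2.2.2.2.1 ∧ r.2.2.2.1 ≠ r.2.2.2.2.2.2.2)))
    (hchain : List.IsChain (fun r r' => r'.2.2.2.2.2 =
      (if r.1 = 0 then (r.2.2.2.2.2.1, r.2.2.2.2.1, r.2.2.2.2.2.2.2)
       else if r.1 = 2 then (r.2.2.2.2.2.1, r.2.2.2.2.2.2.1, r.2.2.2.2.1)
       else (r.2.2.2.2.1, r.2.2.2.2.2.2.1, r.2.2.2.2.2.2.2))) L)
    (hpair : L.Pairwise (fun r r' => r.2.2.2.1 ∉ ends r'.2.1 ∧ r.2.2.2.1 ∉ ends r'.2.2.1))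
    (p : E → R) (hp : IsProbVec p)
    (hzero : ∀ r ∈ L, ∀ e, r.2.2.2.1 ∈ ends e → (∃ r' ∈ L, e = r'.2.1 ∨ e = r'.2.2.1) ∨ p e = 0)
    (hloop : ∀ e, (∀ r ∈ L, e ≠ r.2.1 ∧ e ≠ r.2.2.1) → p e ≠ 0 → ¬ (ends e).IsDiag)
    (hinj : ∀ e e', (∀ r ∈ L, e ≠ r.2.1 ∧ e ≠ r.2.2.1) → p e ≠ 0 →
      (∀ r ∈ L, e' ≠ r.2.1 ∧ e' ≠ r.2.2.1) → p e' ≠ 0 → ends e = ends e' → e = e')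
    (hacyc : (openGraph ends (fun e => decide ((∀ r ∈ L, e ≠ r.2.1 ∧ e ≠ r.2.2.1) ∧ p e ≠ 0))).IsAcyclic)
    (m : V × V × V) (hhead : ∀ r, L.head? = some r → r.2.2.2.2.2 = m)
    {𝓔 : Set (Set V)} (h𝓔 : IsUpperSet 𝓔) :
    let e := connEvent ends m.1 m.2.1
    let L' := connEvent ends m.1 m.2.2
    let U := clusterInEvent ends m.1 𝓔
    let γ := connEvent ends m.2.1 m.2.2
    0 ≤ prob p (eᶜ ∩ L'ᶜ ∩ γᶜ) * (prob p (U ∩ (e ∩ L')) - prob p U * prob p (e ∩ L'))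
      - prob p (eᶜ ∩ L'ᶜ ∩ γ) * (prob p (U ∩ (e ∩ L'ᶜ)) - prob p U * prob p (e ∩ L'ᶜ)) := by
  refine zc_of_mixed_chain L hrec hchain hpair p hp hzero m 𝓔 h𝓔 hhead ?_
  intro 𝓔' h𝓔'
  simp only
  set p₀ := L.foldl (fun q r => Function.update (Function.update q r.2.1 0) r.2.2.1 0) p with hp₀
  have hp₀' : IsProbVec p₀ := by
    rw [hp₀]
    clear hp₀ hacyc hinj hloop hzero hrec hchain hpair hhead
    induction L generalizing p with
    | nil => exact hp
    | cons r L ih =>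
      rw [List.foldl_cons]
      exact ih _ ((hp.update r.2.1 le_rfl zero_le_one).update r.2.2.1 le_rfl zero_le_one)
  have hsupp : ∀ e, p₀ e ≠ 0 ↔ (∀ r ∈ L, e ≠ r.2.1 ∧ e ≠ r.2.2.1) ∧ p e ≠ 0 :=
    foldl_update_two_zero_ne_zero_iff L p
  have hconf : (fun e => decide (p₀ e ≠ 0))
      = fun e => decide ((∀ r ∈ L, e ≠ r.2.1 ∧ e ≠ r.2.2.1) ∧ p e ≠ 0) := by
    funext e; simp only [hsupp]
  refine zc_of_forest_support ends p₀ hp₀' (fun e he => ?_) (fun e e' he he' h => ?_) ?_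
    _ _ _ 𝓔' h𝓔'
  · obtain ⟨hL, hne⟩ := (hsupp e).1 he
    exact hloop e hL hne
  · obtain ⟨hL, hne⟩ := (hsupp e).1 he
    obtain ⟨hL', hne'⟩ := (hsupp e').1 he'
    exact hinj e e' hL hne hL' hne' h
  · rw [hconf]; exact hacyc

end MixedChainForest

end Summit.Ventures.PercRepro2
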